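import Literature.IUT.HodgeArakelov.PlusMinusTowerStableCurveBridgeH25Datum
import Literature.IUT.HodgeArakelov.LabelClassesOfCuspsR2

/-!
# [IUTchII] Cor 2.4 (i), input (A) at the node's `Π_v`-cuspidal `I_t`: route 2 (`h25_piV`) WITHOUT the refuted `Def23_ii` — repair file

S. Mochizuki, *Inter-universal Teichmüller theory II*, kurims manuscript (Dec. 2020), §2, Def 2.3 (ii) p. 68 l. 4–9,
Cor 2.4 (i) pp. 69–71; *Inter-universal Teichmüller theory I*, Prop 2.4 (i)/(iii) pp. 50–51, Cor 2.5 p. 51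
([IUTchII] Cor 2.4 (i), kurims pp.69-71) [claim: Mochizuki2012, status: disputed] (D-0012 claim key; series DISPUTED;
every [IUTchI]/[IUTchII] input below is a HYPOTHESIS, named by the tree's typed predicates; nothing printed is asserted).

PROOF-ONLY repair companion (abc-iut cell, wave 5, seat abc-iut-w5-d132; no definitions) of abc-iut-w5-d121's
`PlusMinusTowerStableCurveBridgeH25.lean` (p413689) / `…H25Datum.lean` (p414707).  FINDING (RQ7 second pass of
p413689/p414707): their theorems `inputA1_of_prop24i`, `h25_piV`, `h25_piV_of_prop24iii`, `inputA1_of_proSigmaPart`,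
`h25_piV_of_proSigmaPart(_of_prop24iii)` take the hypothesis `hrel : Def23_ii C W.piV W.piPM` — abc-iut-L6-t1's ORIGINAL
rendering of Def 2.3 (ii), whose THIRD conjunct ("the cuspidal inertia groups of `Π_⊇` are the `Π_⊇`-conjugates of the
NORMALISERS IN `Π_⊇` of those of `Π_⊆`") is FALSE at the intended model (in the arithmetic `Π^±_v` the normaliser of a
cuspidal inertia group is its decomposition group: finding T1-F9 of abc-iut-L6-t19, repaired as `Def23_ii'` in
`LabelClassesOfCuspsR2.lean`, normaliser taken in `Δ_⊇`).  The proofs use ONLY the (true) second conjunct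
(`hrel.2.1`: "`I = I' ∩ Π_v`, of finite index in a cuspidal inertia group `I'` of `Π^±_v`", p. 68 l. 4–6), but AS
TYPED the theorems cannot be instantiated at the model (their hypothesis is unsatisfiable there), i.e. route 2 of
MERGE-MAP DD1 is vacuous as filed.  REPAIR (here): the same theorems over the clause actually used —

* `StableCurveAgreement.inputA1_of_proSigmaPart'` / `h25_piV'` / `h25_piV'_of_prop24iii` — hypothesis
  `hrel₂ : ∀ I, C.IsCuspidalInertia W.piV I → ∃ I', C.IsCuspidalInertia W.piPM I' ∧ ((I' ⊓ W.piV).subgroupOf I').FiniteIndex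
  ∧ I = I' ⊓ W.piV` (Def 2.3 (ii) second sentence, forward direction), everything else as in p414707 (B13 agreement,
  `D.Prop24i`, normal terminality / `D.Prop24iii`, per-cusp pro-`Σ` datum `hPx`, `Π^tp_{X_v}` Hausdorff); proof =
  abc-iut-w5-d121's, verbatim up to the first line.  PROVED.
* `h25_piV'_of_def23ii'` — the same from the REPAIRED named statement `Def23_ii' C W.piV W.piPM` (its conjunct 2).
  (From the original `Def23_ii` one recovers abc-iut-w5-d121's `h25_piV_of_proSigmaPart_of_prop24iii` verbatim, by
  `fun I hI => (hrel.2.1 I).mp hI` — not restated here.)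

Typed ≠ proved; no side is taken on [IUTchIII] Cor 3.12.
-/

namespace Literature.IUT.HodgeArakelov

open Literature.IUT.HodgeTheaters
open Literature.AnabelianGeometry.AbsoluteAnabelian (IsNormallyTerminal)
open Literature.AnabelianGeometry.SemiGraphs (IsProSigma)
open scoped Pointwise

universe u

variable {S : BadPlaceSetting.{u}} {P : TopGroup.{u}} {T : TemperedCoverings S P}

namespace PlusMinusTower

namespace StableCurveAgreement

variable {W : PlusMinusTower T} {C : CuspidalInertiaData W} {D : StableCurveTemperedData.{u}}

/-- **IUTchI:Cor2.5** (kurims p.51) **Input (A1) of [IUTchII] Cor 2.4 (i) at the node's `Π_v`-cuspidal inertia group — over the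
clause of Def 2.3 (ii) actually used.**  For `I ⊆ Π_v` cuspidal OF `Π_v` and `γ ∈ Π̂^±_v`: `I ⊆ (Π^±_v)^γ ⟹ (Π^±_v)^γ = Π^±_v`.
HYPOTHESES (named, none asserted): the B13 agreement `A`; [IUTchI] Prop 2.4 (i) for `X_v` (`D.Prop24i`); the SECOND
sentence of [IUTchII] Def 2.3 (ii) p. 68 for `Π_v ⊆ Π^±_v`, forward direction (`hrel₂`: "`I = I' ∩ Π_v`, of finite index
in a cuspidal inertia group `I'` of `Π^±_v`" — conjunct 2 of both `Def23_ii` and the repaired `Def23_ii'`); the per-cusp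
pro-`Σ` datum `hPx`; `Π^tp_{X_v}` Hausdorff.  Proof: abc-iut-w5-d121's `inputA1_of_proSigmaPart` (p414707) verbatim after
its first line. PROVED. [claim: Mochizuki2012, status: disputed] -/
theorem inputA1_of_proSigmaPart' [T2Space D.PiTp] (A : StableCurveAgreement W C D) (h24i : D.Prop24i)
    (hrel₂ : ∀ I, C.IsCuspidalInertia W.piV I →
      ∃ I', C.IsCuspidalInertia W.piPM I' ∧ ((I' ⊓ W.piV).subgroupOf I').FiniteIndex ∧ I = I' ⊓ W.piV)
    (hPx : ∀ x : D.Cusp, ∃ Q : Subgroup D.DeltaTp, Q ≤ D.inertiaTp x ∧ IsCompact (Q : Set D.DeltaTp) ∧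
      (Q : Set D.DeltaTp).Infinite ∧ IsProSigma D.graph.Sigma Q ∧ TotallyDisconnectedSpace Q)
    {I : Subgroup W.Corhat} (hI : C.IsCuspidalInertia W.piV I) :
    ∀ γ : W.Corhat, γ ∈ W.pmHat → I ≤ W.piPM.map (MulAut.conj γ).toMonoidHom →
      W.piPM.map (MulAut.conj γ).toMonoidHom = W.piPM := by
  intro γ hγ hc
  -- Def 2.3 (ii), second sentence: `I = I' ∩ Π_v`, finite index in a cuspidal inertia group `I'` of `Π^±_v`
  obtain ⟨I', hI', hfi, rfl⟩ := hrel₂ I hI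
  -- the agreement: `I' ⊆ Π^±_v` is carried onto a `Π^tp_{X_v}`-conjugate of some `I_x`
  obtain ⟨hI'pm, x, t, hK⟩ := (A.inertia_iff I').mp hI'
  have hI'hat : I' ≤ W.pmHat := hI'pm.trans W.emb_le_pmHat
  set g : D.PiHat := A.eHat ⟨γ, hγ⟩ with hg
  -- the homomorphism `d ↦ ι(t d t⁻¹)` on `Δ^tp_{X_v}`
  set f : D.DeltaTp →* D.PiHat := (D.ιX.comp (MulAut.conj t).toMonoidHom).comp D.DeltaTp.subtype with hf
  have hKf : (MulAut.conj t • (D.inertiaTp x).map D.DeltaTp.subtype).map D.ιX = (D.inertiaTp x).map f := by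
    ext y
    simp only [hf, Subgroup.mem_map, MonoidHom.coe_comp, Function.comp_apply, Subgroup.coe_subtype,
      MulEquiv.coe_toMonoidHom, MulAut.conj_apply, Subgroup.mem_pointwise_smul_iff_inv_smul_mem,
      MulAut.smul_def, MulAut.conj_inv_apply]
    constructor
    · rintro ⟨z, ⟨p, hp, hpz⟩, rfl⟩
      refine ⟨p, hp, ?_⟩
      have e : (p : D.PiTp) = t⁻¹ * z * t := hpz
      rw [e]; congr 1; group
    · rintro ⟨p, hp, rfl⟩
      exact ⟨t * (p : D.PiTp) * t⁻¹, ⟨p, hp, by group⟩, rfl⟩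
  set J : Subgroup D.PiHat := ((I' ⊓ W.piV).subgroupOf W.pmHat).map A.eHat.toMonoidHom with hJ
  -- `J ⊆ f(I_x)`, of finite index
  have hJfi : J.relIndex ((D.inertiaTp x).map f) ≠ 0 := by
    rw [← hKf, hJ, ← hK, Subgroup.relIndex_map_map_of_injective _ _ A.eHat.injective,
      Subgroup.relIndex_subgroupOf hI'hat]
    exact hfi.index_ne_zero
  -- `J ⊆ (Π^tp_{X_v})^g`, transported from `I' ∩ Π_v ⊆ (Π^±_v)^γ`
  have hJg : J ≤ MulAut.conj g • D.ιX.range := by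
    rintro _ ⟨q, hq, rfl⟩
    have hqI : (q : W.Corhat) ∈ I' ⊓ W.piV := Subgroup.mem_subgroupOf.mp hq
    have hq' : γ⁻¹ * (q : W.Corhat) * γ ∈ W.piPM := by
      have := hc hqI
      rwa [Subgroup.mem_map_equiv, MulAut.conj_symm_apply] at this
    rw [Subgroup.mem_pointwise_smul_iff_inv_smul_mem, MulAut.smul_def, MulAut.conj_inv_apply,
      MulEquiv.coe_toMonoidHom, hg, ← A.eHat_conj_inv hγ q.2]
    exact (A.mem_piPM_iff ⟨_, _⟩).mp hq'
  -- the pro-`Σ` part of `I_x`, cut down to `J`, then Prop 2.4 (i)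
  obtain ⟨P₀, hP₀I, hP₀c, hP₀inf, hP₀S, hP₀td⟩ := hPx x
  obtain ⟨Q, -, hQJ, hQc, hQne, hQS⟩ :=
    Subgroup.exists_proSigma_le_map_le_of_relIndex (D.inertiaTp x) P₀ hP₀I hP₀c hP₀inf hP₀S hP₀td f J hJfi
  have hQf : (MulAut.conj t • Q.map D.DeltaTp.subtype).map D.ιX = Q.map f := by
    ext y
    simp only [hf, Subgroup.mem_map, MonoidHom.coe_comp, Function.comp_apply, Subgroup.coe_subtype,
      MulEquiv.coe_toMonoidHom, MulAut.conj_apply, Subgroup.mem_pointwise_smul_iff_inv_smul_mem,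
      MulAut.smul_def, MulAut.conj_inv_apply]
    constructor
    · rintro ⟨z, ⟨p, hp, hpz⟩, rfl⟩
      refine ⟨p, hp, ?_⟩
      have e : (p : D.PiTp) = t⁻¹ * z * t := hpz
      rw [e]; congr 1; group
    · rintro ⟨p, hp, rfl⟩
      exact ⟨t * (p : D.PiTp) * t⁻¹, ⟨p, hp, by group⟩, rfl⟩
  have heq : MulAut.conj g • D.ιX.range = D.ιX.range :=
    D.conj_range_eq_of_conj_proSigma_le h24i Q hQc hQne hQS t g (hQf ▸ hQJ.trans hJg)
  exact (A.conj_piPM_eq_iff hγ).mpr heq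

/-- **IUTchII:Cor2.4(i)** (kurims p.70 l.−3) **The binder `h25` of `cor24_i_of_inputs` at the node's `Π_v`-cuspidal `I`,
over the clause of Def 2.3 (ii) actually used** ("by [IUTchI], Corollary 2.5 [cf. also [IUTchI], Remark 2.5.2], the
inclusion `I^{γ'}_t ⊆ Π^±_{v□} ⊆ Π^±_v` implies that `γ' ∈ Δ^±_v`"): for `γ' ∈ Δ̂^±_v`, `I^{γ'} ⊆ Π^±_v ⟹ γ' ∈ Π^±_v`.
From `inputA1_of_proSigmaPart'` (at `γ'⁻¹`) and abc-iut-w5-d121's `inputA2_of_normallyTerminal`.  PROVED.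
[claim: Mochizuki2012, status: disputed] -/
theorem h25_piV' [T2Space D.PiTp] (A : StableCurveAgreement W C D) (h24i : D.Prop24i)
    (hNT : IsNormallyTerminal D.ιX.range)
    (hrel₂ : ∀ I, C.IsCuspidalInertia W.piV I →
      ∃ I', C.IsCuspidalInertia W.piPM I' ∧ ((I' ⊓ W.piV).subgroupOf I').FiniteIndex ∧ I = I' ⊓ W.piV)
    (hPx : ∀ x : D.Cusp, ∃ Q : Subgroup D.DeltaTp, Q ≤ D.inertiaTp x ∧ IsCompact (Q : Set D.DeltaTp) ∧
      (Q : Set D.DeltaTp).Infinite ∧ IsProSigma D.graph.Sigma Q ∧ TotallyDisconnectedSpace Q)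
    {I : Subgroup W.Corhat} (hI : C.IsCuspidalInertia W.piV I) :
    ∀ γ' : W.Corhat, γ' ∈ W.pmHat ⊓ W.aug.ker →
      I.map (MulAut.conj γ').toMonoidHom ≤ W.piPM → γ' ∈ W.piPM := by
  intro γ' hγ' hc
  have hγ'hat : γ'⁻¹ ∈ W.pmHat := W.pmHat.inv_mem (Subgroup.mem_inf.mp hγ').1
  have hI' : I ≤ W.piPM.map (MulAut.conj γ'⁻¹).toMonoidHom := by
    intro x hx
    rw [Subgroup.mem_map_equiv, MulAut.conj_symm_apply, inv_inv]
    exact hc ⟨x, hx, rfl⟩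
  have hE := A.inputA1_of_proSigmaPart' h24i hrel₂ hPx hI γ'⁻¹ hγ'hat hI'
  exact (Subgroup.inv_mem_iff W.piPM).mp (A.inputA2_of_normallyTerminal hNT γ'⁻¹ hγ'hat hE)

/-- **IUTchII:Cor2.4(i)** (kurims pp.70–71) `h25_piV'` with the normal terminality supplied by abc-iut-L5-t1's typed [IUTchI]
Prop 2.4 (iii) (`D.Prop24iii`). PROVED. [claim: Mochizuki2012, status: disputed] -/
theorem h25_piV'_of_prop24iii [T2Space D.PiTp] (A : StableCurveAgreement W C D) (h24i : D.Prop24i)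
    (h24iii : D.Prop24iii)
    (hrel₂ : ∀ I, C.IsCuspidalInertia W.piV I →
      ∃ I', C.IsCuspidalInertia W.piPM I' ∧ ((I' ⊓ W.piV).subgroupOf I').FiniteIndex ∧ I = I' ⊓ W.piV)
    (hPx : ∀ x : D.Cusp, ∃ Q : Subgroup D.DeltaTp, Q ≤ D.inertiaTp x ∧ IsCompact (Q : Set D.DeltaTp) ∧
      (Q : Set D.DeltaTp).Infinite ∧ IsProSigma D.graph.Sigma Q ∧ TotallyDisconnectedSpace Q)
    {I : Subgroup W.Corhat} (hI : C.IsCuspidalInertia W.piV I) :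
    ∀ γ' : W.Corhat, γ' ∈ W.pmHat ⊓ W.aug.ker →
      I.map (MulAut.conj γ').toMonoidHom ≤ W.piPM → γ' ∈ W.piPM :=
  A.h25_piV' h24i h24iii.pi.isNormallyTerminal hrel₂ hPx hI

/-- **IUTchII:Def2.3(ii)′** (kurims p.68) — `h25` at the node's `Π_v`-cuspidal `I` from the REPAIRED named statement `Def23_ii' C W.piV W.piPM`
(abc-iut-L6-t19, `LabelClassesOfCuspsR2.lean`; conjunct 2 is what is used), together with the B13 agreement,
`D.Prop24i`, `D.Prop24iii` and the per-cusp pro-`Σ` datum — the NON-VACUOUS form of route 2. PROVED.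
[claim: Mochizuki2012, status: disputed] -/
theorem h25_piV'_of_def23ii' [T2Space D.PiTp] (A : StableCurveAgreement W C D) (h24i : D.Prop24i)
    (h24iii : D.Prop24iii) (hrel' : Def23_ii' C W.piV W.piPM)
    (hPx : ∀ x : D.Cusp, ∃ Q : Subgroup D.DeltaTp, Q ≤ D.inertiaTp x ∧ IsCompact (Q : Set D.DeltaTp) ∧
      (Q : Set D.DeltaTp).Infinite ∧ IsProSigma D.graph.Sigma Q ∧ TotallyDisconnectedSpace Q)
    {I : Subgroup W.Corhat} (hI : C.IsCuspidalInertia W.piV I) :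
    ∀ γ' : W.Corhat, γ' ∈ W.pmHat ⊓ W.aug.ker →
      I.map (MulAut.conj γ').toMonoidHom ≤ W.piPM → γ' ∈ W.piPM :=
  A.h25_piV'_of_prop24iii h24i h24iii (fun I hI => (hrel'.2.1 I).mp hI) hPx hI

end StableCurveAgreement

end PlusMinusTower

end Literature.IUT.HodgeArakelov
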